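import Summits.HodgeConjecture.HodgeConjecture.Theorems.H413E2SWSplitPlaceFrame
import HarnessLib

/-!
# H413 · E-2 · SW2 (iii) — RIDERS of the split-place frame for the (S-3θ) null-fibre carrier

Cell `hodgecm-mathlib`, crux H413 (`stmt-HodgeConjecture-24833`), child line `Cruxes/H413/Lines/F0_E2SiegelWeilWeilRange.lean`,
`StubSW2` (iii); sibling of ★ `Theorems/H413E2SWSplitPlaceFrame` (p810752; the cell's 400-line bound for Theorems files keeps these
riders in their own file).  PROOF lane, `--supports stmt-HodgeConjecture-24833 --as helper`.  HC_CM is proved only modulo the 7 printed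
citations until rung 0 closes; nothing here is about Hodge classes.

Two further clauses of the split-place frame `β_v` asked by the (S-3θ) statement cut (B-p03 (g23), `Theorems/H413E2SWThetaNullFibreCarrierCM`):
* **`exists_gl_frame_intertwine`** — EVERY `h ∈ U(J_V)(𝔸_F)` (not only the selected `v`-supported ones) acts at `v`, in the coordinates
  `β_v`, as a dual pair `(g, (g⁻¹)ᵀ)` for some `g ∈ GL_n(F_v)` (★ `evalAt_vDiagAct_comp` + ★ `exists_gl_split_intertwine_adicCompletion`
  at `(h ⊗ 1)|_v`, ★ `map_adeleToLocal_adelicInl_mem`, ★ `adelicPairForm_map_adeleToLocal`);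
* **`beta_evalAt_ratPt_ne_zero`** — RATIONAL POINTS HAVE MAXIMAL RANK at the split place: for `0 ≠ ξ ∈ F^{n+n}` both halves of
  `β_v(ξ)` are non-zero, because `(β ξ)₁ = ξ¹ + s 𝕋⁻¹ξ²`, `(β ξ)₂ = 𝕋 ξ¹ − s ξ²` have RATIONAL ingredients while `s ∉ F`
  (`d = δ²` is not a square in `F`: `ne_mul_self_of_delta`, `sqrt_not_mem_range`) — Weil's «`U(0)_k` … points of maximal rank»;
* **`exists_splitPlaceFrame₂`** — ★ `exists_splitPlaceFrame` ∧ `hrat` ∧ `hint`.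

References: A. Weil, *Acta Math.* 113 (1965), Chap. V n° 50, pp. 73–74 [Weil1965]; S. Gelbart, J. Rogawski, Invent. Math. 105 (1991),
§3.1 p. 454 [GelbartRogawski1991].
-/

set_option autoImplicit false
-- the cell's `Summit.HodgeConjecture.HodgeConjecture.…` namespace repeats the summit name by design (D-0017 layout)
set_option linter.dupNamespace false

noncomputable section

namespace Summit.HodgeConjecture.HodgeConjecture.Cruxes.H413.E2SWSplitPlaceFrame

open scoped Matrix Kronecker NNReal ENNReal
open _root_.MeasureTheory NumberField IsDedekindDomain
open Literature.RepresentationTheory.HeisenbergGroup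
open Literature.RepresentationTheory.HeisenbergGroup.SymplecticMatrix
open Literature.NumberTheory.Weil1964 Literature.NumberTheory.Weil1965 Literature.NumberTheory.Weil1965.UnitaryDoubling
open Literature.NumberTheory.Automorphic Literature.NumberTheory.Automorphic.UnitaryGroup
open Literature.NumberTheory.Automorphic.UnitaryGroup.QuadraticCoordinates
open Literature.NumberTheory.GelbartRogawski1991 Literature.NumberTheory.GelbartRogawski1991.UnitaryDualPair
open Literature.NumberTheory.Automorphic.AdelicVector (evalAt evalAt_apply trivialAt placeSplitting single evalAt_single)

variable (F E : Type) [Field F] [NumberField F] [Field E] [NumberField E] [Algebra F E] [Algebra.IsQuadraticExtension F E]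
  (c : E ≃ₐ[F] E) {δ : E} (hcδ : c δ = -δ) (hδ : δ ≠ 0) {d : F} (hd : δ * δ = algebraMap F E d)
  (N : ℕ) {n : ℕ} (e : Fin N × Fin 1 ≃ Fin n)
  (TV : Matrix (Fin N) (Fin N) F) (hV : TV.IsSymm) (hVd : IsUnit TV.det)
  (TW : Matrix (Fin 1) (Fin 1) F) (hW : TW.IsSymm) (hWd : IsUnit TW.det)
  (v : HeightOneSpectrum (𝓞 F))


/-! ## Riders for (S-3θ): every adelic `h` intertwines; rational points have maximal rank at the split place -/

include hV hW hd in
/-- **EVERY `h ∈ U(J_V)(𝔸_F)` ACTS AT `v`, IN THE SPLIT COORDINATES, AS A DUAL PAIR `(g, (g⁻¹)ᵀ)`** for some `g ∈ GL_n(F_v)`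
(not only the selected `v`-supported ones): ★ `evalAt_vDiagAct_comp` (the `v`-component of `A_h x` is the local action of `(h ⊗ 1)|_v`)
+ ★ `exists_gl_split_intertwine_adicCompletion` at `g := (h ⊗ 1)|_v` (★ `map_adeleToLocal_adelicInl_mem`, ★ `adelicPairForm_map_adeleToLocal`).
[cite: Weil1965, Chap. V n° 50, pp. 73–74] -/
theorem exists_gl_frame_intertwine {s : v.adicCompletion F} (hs : s * s = algebraMap F (v.adicCompletion F) d)
    (β : (Fin (n + n) → v.adicCompletion F) ≃ₗ[v.adicCompletion F] ((Fin n → v.adicCompletion F) × (Fin n → v.adicCompletion F)))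
    (hβ : ∀ y, β y =
        ((fun i => y (Fin.castAdd n i)) +
            s • ((UnitaryDualPair.gram F e TV TW).map (algebraMap F (v.adicCompletion F)))⁻¹ *ᵥ (fun i => y (Fin.natAdd n i)),
          (UnitaryDualPair.gram F e TV TW).map (algebraMap F (v.adicCompletion F)) *ᵥ (fun i => y (Fin.castAdd n i)) -
            s • (fun i => y (Fin.natAdd n i))))
    (hU : UnitaryGroup.adelic F E c N (TV.map (algebraMap F E))) :
    ∃ g : GL (Fin n) (v.adicCompletion F), ∀ x : Fin (n + n) → AdeleRing (𝓞 F) F,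
      β (evalAt F (Fin (n + n)) v (vDiagAct F E c hcδ hδ hd N e TV hV hVd TW hW hWd hU x)) =
        ((g : Matrix (Fin n) (Fin n) (v.adicCompletion F)) *ᵥ (β (evalAt F (Fin (n + n)) v x)).1,
          ((g⁻¹ : GL (Fin n) (v.adicCompletion F)) : Matrix (Fin n) (Fin n) (v.adicCompletion F))ᵀ *ᵥ
            (β (evalAt F (Fin (n + n)) v x)).2) := by
  set G : GL (Fin N × Fin 1) (LocalRing E v) := Matrix.GeneralLinearGroup.map (adeleToLocal E v)
      ((adelicInl F E c N 1 (TV.map (algebraMap F E)) (TW.map (algebraMap F E)) hU :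
        adelicPair F E c N 1 (TV.map (algebraMap F E)) (TW.map (algebraMap F E))) : GL (Fin N × Fin 1) (AdeleRing (𝓞 E) E)) with hGdef
  have hG : G ∈ unitaryGroupOfForm (conjLocal E c v)
      ((TV.map (algebraMap F (v.adicCompletion F)) ⊗ₖ TW.map (algebraMap F (v.adicCompletion F))).map (toLocalRing E v)) := by
    rw [← adelicPairForm_map_adeleToLocal F E N TV TW v]
    exact map_adeleToLocal_adelicInl_mem F E c N TV TW v hU
  obtain ⟨gW, -, -, hint⟩ := exists_gl_split_intertwine_adicCompletion F E c hcδ hδ hd N e TV hV hVd TW hW hWd v hs hG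
  refine ⟨gW, fun x => ?_⟩
  have hcomp := evalAt_vDiagAct_comp F E c hcδ hδ hd N e TV hV hVd TW hW hWd v hU x
  rw [← hGdef] at hcomp
  set y := evalAt F (Fin (n + n)) v x with hy
  set Ay := SymplecticMatrix.darboux ((UnitaryDualPair.gram F e TV TW).map (algebraMap F (v.adicCompletion F)))
      (isUnit_det_gram_map_adicCompletion F N e TV hVd TW hWd v)
      (reindexW (v.adicCompletion F) e
        ((isQuadraticCoordinates_local E v c hcδ hδ hd).resAut (Fin N × Fin 1) G
          ((reindexW (v.adicCompletion F) e).symm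
            ((SymplecticMatrix.darboux ((UnitaryDualPair.gram F e TV TW).map (algebraMap F (v.adicCompletion F)))
                (isUnit_det_gram_map_adicCompletion F N e TV hVd TW hWd v)).symm (y ∘ ⇑finSumFinEquiv))))) with hAy
  have h1 : (fun i => evalAt F (Fin (n + n)) v (vDiagAct F E c hcδ hδ hd N e TV hV hVd TW hW hWd hU x) (Fin.castAdd n i)) =
      Ay ∘ Sum.inl := by
    funext i
    have := congrFun hcomp (Sum.inl i)
    simp only [Function.comp_apply, finSumFinEquiv_apply_left] at this
    exact this
  have h2 : (fun i => evalAt F (Fin (n + n)) v (vDiagAct F E c hcδ hδ hd N e TV hV hVd TW hW hWd hU x) (Fin.natAdd n i)) =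
      Ay ∘ Sum.inr := by
    funext i
    have := congrFun hcomp (Sum.inr i)
    simp only [Function.comp_apply, finSumFinEquiv_apply_right] at this
    exact this
  have hint' := hint y
  rw [← hAy] at hint'
  rw [hβ, hβ, h1, h2]
  exact Prod.ext hint'.1 hint'.2

omit [NumberField F] [Algebra.IsQuadraticExtension F E] in
include hcδ in
/-- `d = δ²` is not a square in `F` (else `δ = ±t ∈ F` would be fixed by `c`). [cite: Weil1965, Chap. V n° 50, pp. 73–74] -/
theorem ne_mul_self_of_delta {d : F} (hd : δ * δ = algebraMap F E d) (hδ : δ ≠ 0) (t : F) : t * t ≠ d := by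
  intro ht
  have hsq : (δ - algebraMap F E t) * (δ + algebraMap F E t) = 0 := by
    have : algebraMap F E t * algebraMap F E t = δ * δ := by rw [← map_mul, ht, hd]
    linear_combination -this
  have hfix : c δ = δ := by
    rcases mul_eq_zero.mp hsq with h | h
    · rw [sub_eq_zero.mp h, AlgEquiv.commutes]
    · rw [eq_neg_of_add_eq_zero_left h, map_neg, AlgEquiv.commutes]
  rw [hcδ] at hfix
  have h2 : (2 : E) * δ = 0 := by linear_combination -hfix
  exact hδ ((mul_eq_zero.mp h2).resolve_left two_ne_zero)

omit [Algebra.IsQuadraticExtension F E] in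
include hcδ hδ hd in
/-- a square root of `d` in `F_v` is NOT in the image of `F` (`d` is not a square in `F`). [cite: Weil1965, Chap. V n° 50, pp. 73–74] -/
theorem sqrt_not_mem_range {s : v.adicCompletion F} (hs : s * s = algebraMap F (v.adicCompletion F) d) (t : F) :
    s ≠ algebraMap F (v.adicCompletion F) t := by
  intro hst
  apply ne_mul_self_of_delta F E c hcδ hd hδ t
  have h : algebraMap F (v.adicCompletion F) (t * t) = algebraMap F (v.adicCompletion F) d := by
    rw [map_mul, ← hst, hs]
  exact (algebraMap F (v.adicCompletion F)).injective h

omit [Algebra.IsQuadraticExtension F E] [NumberField E] in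
/-- a linear relation `a + s • b = 0` between RATIONAL vectors with `s ∉ F` forces `b = 0` (and then `a = 0`). [folklore] -/
private theorem eq_zero_of_add_smul_eq_zero {s : v.adicCompletion F} (hsF : ∀ t : F, s ≠ algebraMap F (v.adicCompletion F) t)
    (a b : Fin n → F)
    (h : (fun i => algebraMap F (v.adicCompletion F) (a i)) + s • (fun i => algebraMap F (v.adicCompletion F) (b i)) = 0) :
    a = 0 ∧ b = 0 := by
  have hb : b = 0 := by
    by_contra hb
    obtain ⟨j, hj⟩ : ∃ j, b j ≠ 0 := by
      by_contra hall
      push Not at hall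
      exact hb (funext hall)
    have hj' : algebraMap F (v.adicCompletion F) (b j) ≠ 0 := (map_ne_zero _).2 hj
    have hrow := congrFun h j
    simp only [Pi.add_apply, Pi.smul_apply, smul_eq_mul, Pi.zero_apply] at hrow
    have hmul : s * algebraMap F (v.adicCompletion F) (b j) = -algebraMap F (v.adicCompletion F) (a j) := by
      linear_combination hrow
    have hs' : s = -algebraMap F (v.adicCompletion F) (a j) / algebraMap F (v.adicCompletion F) (b j) := by
      rw [eq_div_iff hj']
      exact hmul
    exact hsF (-(a j / b j)) (by rw [hs', map_neg, map_div₀, neg_div])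
  refine ⟨?_, hb⟩
  rw [hb] at h
  funext i
  have hi := congrFun h i
  simp only [Pi.add_apply, Pi.smul_apply, map_zero, smul_zero, add_zero, Pi.zero_apply] at hi
  exact (map_eq_zero _).1 hi


include hVd hWd in
/-- `𝕋_v⁻¹ = (𝕋_F⁻¹) ⊗ 1`: inversion commutes with the base change `F → F_v`. [cite: GelbartRogawski1991, §3.1 p. 454] -/
private theorem gram_map_inv :
    ((UnitaryDualPair.gram F e TV TW).map (algebraMap F (v.adicCompletion F)))⁻¹ =
      (UnitaryDualPair.gram F e TV TW)⁻¹.map (algebraMap F (v.adicCompletion F)) := by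
  have hT : IsUnit (UnitaryDualPair.gram F e TV TW).det := UnitaryDualPair.isUnit_det_gram F e hVd hWd
  refine Matrix.inv_eq_left_inv ?_
  rw [← Matrix.map_mul, Matrix.nonsing_inv_mul _ hT, Matrix.map_one _ (map_zero _) (map_one _)]

omit [Algebra.IsQuadraticExtension F E] [NumberField E] in
/-- `(M ⊗ 1) *ᵥ (f ∘ w) = f ∘ (M *ᵥ w)`. [folklore] -/
private theorem map_mulVec_comp (M : Matrix (Fin n) (Fin n) F) (w : Fin n → F) :
    M.map (algebraMap F (v.adicCompletion F)) *ᵥ (fun i => algebraMap F (v.adicCompletion F) (w i)) =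
      fun i => algebraMap F (v.adicCompletion F) ((M *ᵥ w) i) := by
  funext i
  rw [RingHom.map_mulVec]
  rfl

omit [Algebra.IsQuadraticExtension F E] [NumberField E] [NumberField F] in
/-- a vector indexed by `Fin (n + n)` vanishes iff both halves vanish. [folklore] -/
private theorem eq_zero_of_halves {ξ : Fin (n + n) → F} (h1 : (fun i => ξ (Fin.castAdd n i)) = 0)
    (h2 : (fun i => ξ (Fin.natAdd n i)) = 0) : ξ = 0 := by
  funext i
  induction i using Fin.addCases with
  | left j => exact congrFun h1 j
  | right j => exact congrFun h2 j

omit [Algebra.IsQuadraticExtension F E] in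
include hcδ hδ hd hVd hWd in
/-- **RATIONAL POINTS HAVE MAXIMAL RANK AT THE SPLIT PLACE**: for `ξ ∈ F^{n+n}`, `ξ ≠ 0`, both halves of `β_v(ξ_v)` are non-zero —
`(β ξ)₁ = ξ¹ + s 𝕋⁻¹ξ²`, `(β ξ)₂ = 𝕋ξ¹ − s ξ²` with `ξ¹, 𝕋⁻¹ξ², 𝕋ξ¹, ξ²` RATIONAL and `s ∉ F`, so a vanishing half forces
`ξ¹ = ξ² = 0` (Weil's «`U(0)_k` vide ∕ points of maximal rank»: the `b = 0` carrier clause of the Θ-side fibre measure).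
[cite: Weil1965, Chap. V n° 50, pp. 73–74] -/
theorem beta_evalAt_ratPt_ne_zero {s : v.adicCompletion F} (hs : s * s = algebraMap F (v.adicCompletion F) d)
    (β : (Fin (n + n) → v.adicCompletion F) ≃ₗ[v.adicCompletion F] ((Fin n → v.adicCompletion F) × (Fin n → v.adicCompletion F)))
    (hβ : ∀ y, β y =
        ((fun i => y (Fin.castAdd n i)) +
            s • ((UnitaryDualPair.gram F e TV TW).map (algebraMap F (v.adicCompletion F)))⁻¹ *ᵥ (fun i => y (Fin.natAdd n i)),
          (UnitaryDualPair.gram F e TV TW).map (algebraMap F (v.adicCompletion F)) *ᵥ (fun i => y (Fin.castAdd n i)) -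
            s • (fun i => y (Fin.natAdd n i))))
    (ξ : Fin (n + n) → F) (hξ : ξ ≠ 0) :
    (β (evalAt F (Fin (n + n)) v (ratPt F (Fin (n + n)) ξ))).1 ≠ 0 ∧
      (β (evalAt F (Fin (n + n)) v (ratPt F (Fin (n + n)) ξ))).2 ≠ 0 := by
  have hT : IsUnit (UnitaryDualPair.gram F e TV TW).det := UnitaryDualPair.isUnit_det_gram F e hVd hWd
  have hsF := sqrt_not_mem_range F E c hcδ hδ hd v hs
  set f := algebraMap F (v.adicCompletion F) with hf
  -- the `v`-components of the rational point: `(ratPt ξ)_v = f ∘ ξ`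
  have hy : evalAt F (Fin (n + n)) v (ratPt F (Fin (n + n)) ξ) = fun i => f (ξ i) := rfl
  set ξ1 : Fin n → F := fun i => ξ (Fin.castAdd n i) with hξ1
  set ξ2 : Fin n → F := fun i => ξ (Fin.natAdd n i) with hξ2
  have hnz : ¬ (ξ1 = 0 ∧ ξ2 = 0) := fun h => hξ (eq_zero_of_halves F h.1 h.2)
  -- the two halves in rational form
  have h1 : (β (evalAt F (Fin (n + n)) v (ratPt F (Fin (n + n)) ξ))).1 =
      (fun i => f (ξ1 i)) + s • (fun i => f (((UnitaryDualPair.gram F e TV TW)⁻¹ *ᵥ ξ2) i)) := by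
    rw [hβ, hy]
    change (fun i => f (ξ1 i)) + s • (((UnitaryDualPair.gram F e TV TW).map f)⁻¹ *ᵥ fun i => f (ξ2 i)) = _
    rw [gram_map_inv F N e TV hVd TW hWd v, map_mulVec_comp F v]
  have h2 : (β (evalAt F (Fin (n + n)) v (ratPt F (Fin (n + n)) ξ))).2 =
      (fun i => f ((UnitaryDualPair.gram F e TV TW *ᵥ ξ1) i)) + s • (fun i => f ((-ξ2) i)) := by
    rw [hβ, hy]
    change ((UnitaryDualPair.gram F e TV TW).map f *ᵥ fun i => f (ξ1 i)) - s • (fun i => f (ξ2 i)) = _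
    rw [map_mulVec_comp F v, sub_eq_add_neg, ← smul_neg]
    congr 1
    funext i
    simp only [Pi.neg_apply, Pi.smul_apply, map_neg]
  refine ⟨fun h0 => hnz ?_, fun h0 => hnz ?_⟩
  · rw [h1] at h0
    obtain ⟨ha, hb⟩ := eq_zero_of_add_smul_eq_zero F v hsF _ _ h0
    refine ⟨ha, ?_⟩
    have : UnitaryDualPair.gram F e TV TW *ᵥ ((UnitaryDualPair.gram F e TV TW)⁻¹ *ᵥ ξ2) = ξ2 := by
      rw [Matrix.mulVec_mulVec, Matrix.mul_nonsing_inv _ hT, Matrix.one_mulVec]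
    rw [← this, hb, Matrix.mulVec_zero]
  · rw [h2] at h0
    obtain ⟨ha, hb⟩ := eq_zero_of_add_smul_eq_zero F v hsF _ _ h0
    refine ⟨?_, neg_eq_zero.mp hb⟩
    have : (UnitaryDualPair.gram F e TV TW)⁻¹ *ᵥ (UnitaryDualPair.gram F e TV TW *ᵥ ξ1) = ξ1 := by
      rw [Matrix.mulVec_mulVec, Matrix.nonsing_inv_mul _ hT, Matrix.one_mulVec]
    rw [← this, ha, Matrix.mulVec_zero]

include hδ in
/-- **THE SPLIT-PLACE FRAME WITH THE TWO (S-3θ) RIDERS**: ★ `exists_splitPlaceFrame` ∧ `hrat` (rational points of maximal rank,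
`beta_evalAt_ratPt_ne_zero`) ∧ `hint` (every adelic `h` intertwines with some dual pair `(g, (g⁻¹)ᵀ)`, `exists_gl_frame_intertwine`).
[cite: Weil1965, Chap. V n° 50, pp. 73–74] -/
theorem exists_splitPlaceFrame₂ {s : v.adicCompletion F} (hs : s * s = algebraMap F (v.adicCompletion F) d)
    [MeasurableSpace (v.adicCompletion F)] [BorelSpace (v.adicCompletion F)]
    (μ : Measure (v.adicCompletion F)) [μ.IsAddHaarMeasure] :
    ∃ β : (Fin (n + n) → v.adicCompletion F) ≃ₗ[v.adicCompletion F] ((Fin n → v.adicCompletion F) × (Fin n → v.adicCompletion F)),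
      (∀ x : Fin (n + n) → AdeleRing (𝓞 F) F,
        AdelicGroupData.adeleEval F v (hNorm F E c hcδ hδ N e TV hVd TW hWd x) =
          (β (evalAt F (Fin (n + n)) v x)).1 ⬝ᵥ (β (evalAt F (Fin (n + n)) v x)).2) ∧
      (∃ cst : ℝ≥0, 0 < cst ∧
        Measure.map β (Measure.pi fun _ : Fin (n + n) => μ) =
          (cst : ℝ≥0∞) • ((Measure.pi fun _ : Fin n => μ).prod (Measure.pi fun _ : Fin n => μ))) ∧
      (∀ P : GL (Fin n) (v.adicCompletion F), ∃ h : UnitaryGroup.adelic F E c N (TV.map (algebraMap F E)),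
        (∀ y ∈ trivialAt F (Fin (n + n)) v, vDiagAct F E c hcδ hδ hd N e TV hV hVd TW hW hWd h y = y) ∧
        (∀ x : Fin (n + n) → AdeleRing (𝓞 F) F,
          β (evalAt F (Fin (n + n)) v (vDiagAct F E c hcδ hδ hd N e TV hV hVd TW hW hWd h x)) =
            ((P : Matrix (Fin n) (Fin n) (v.adicCompletion F)) *ᵥ (β (evalAt F (Fin (n + n)) v x)).1,
              ((P⁻¹ : GL (Fin n) (v.adicCompletion F)) : Matrix (Fin n) (Fin n) (v.adicCompletion F))ᵀ *ᵥ
                (β (evalAt F (Fin (n + n)) v x)).2)) ∧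
        (∀ x : Fin (n + n) → AdeleRing (𝓞 F) F,
          ((placeSplitting F (Fin (n + n)) v).symm (vDiagAct F E c hcδ hδ hd N e TV hV hVd TW hW hWd h x)).2 =
            ((placeSplitting F (Fin (n + n)) v).symm x).2)) ∧
      (∀ ξ : Fin (n + n) → F, ξ ≠ 0 →
        (β (evalAt F (Fin (n + n)) v (ratPt F (Fin (n + n)) ξ))).1 ≠ 0 ∧
          (β (evalAt F (Fin (n + n)) v (ratPt F (Fin (n + n)) ξ))).2 ≠ 0) ∧
      (∀ hU : UnitaryGroup.adelic F E c N (TV.map (algebraMap F E)), ∃ g : GL (Fin n) (v.adicCompletion F),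
        ∀ x : Fin (n + n) → AdeleRing (𝓞 F) F,
          β (evalAt F (Fin (n + n)) v (vDiagAct F E c hcδ hδ hd N e TV hV hVd TW hW hWd hU x)) =
            ((g : Matrix (Fin n) (Fin n) (v.adicCompletion F)) *ᵥ (β (evalAt F (Fin (n + n)) v x)).1,
              ((g⁻¹ : GL (Fin n) (v.adicCompletion F)) : Matrix (Fin n) (Fin n) (v.adicCompletion F))ᵀ *ᵥ
                (β (evalAt F (Fin (n + n)) v x)).2)) := by
  obtain ⟨β, hβ, -, hQ, hHaar⟩ := exists_splitBeta_adicCompletion F E hδ hd N e TV hV hVd TW hW hWd v μ hs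
  refine ⟨β, fun x => ?_, hHaar, fun P => exists_vSupported_realising F E c hcδ hδ hd N e TV hV hVd TW hW hWd v hs β hβ P,
    fun ξ hξ => beta_evalAt_ratPt_ne_zero F E c hcδ hδ hd N e TV hVd TW hWd v hs β hβ ξ hξ,
    fun hU => exists_gl_frame_intertwine F E c hcδ hδ hd N e TV hV hVd TW hW hWd v hs β hβ hU⟩
  rw [evalAt_hNorm F E c hcδ hδ hd N e TV hVd TW hWd v x]
  exact hQ _

end Summit.HodgeConjecture.HodgeConjecture.Cruxes.H413.E2SWSplitPlaceFrame
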